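import Literature.MathematicalPhysics.QuantumFieldTheory.Federbush1986.ModeAnalyticityThm31Refutation
import Literature.MathematicalPhysics.QuantumFieldTheory.Federbush1986.AbelianModeEstimates

/-!
# `Federbush1986.PrintedModeNoExponentialDecay` — [Federbush1986PhaseCellI] (3.13) p. 328 «|A^N_μ(x)| < ce^{−γ|x|}» is FALSE
# for μ = 1 when «A^N_μ(x) is the Fourier transform of Ã(p)», Ã_i = A′_i + p_iX, with the X(p) PRINTED in Part II
# [FederbushWilliamson1987PhaseCellII] (2.4)–(2.5): a converse Paley–Wiener step on top of p04's `no_holomorphic_extension`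

statement-level skeleton of published theorems with citation tags; proofs where landed; nothing here is a claim about the Yang–Mills mass gap

CITATION HEADER.  P. Federbush, *A phase cell approach to Yang–Mills theory. I. Modes, lattice-continuum duality*, Commun. Math.
Phys. **107** (1986) 319–329 [Federbush1986PhaseCellI] (in the lit store as `paper:url-fbe4197787cb`; p. 328 = PDF p. 10, OCR
`run/shared/lean/pub/pub-balaban/t4/b2b-balaban-t4-lit2/texts/fed1986-cmp107/p010.txt`, render `HOME/lit-balaban-r17/renders/fedI/
fed1986-cmp107-p010-x2.png`), verbatim: *«A^N_μ(x) is the Fourier transform of Ã(p), where Ã_i(p) = A′_i(p) + p_iX(p) for a suitable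
X(p) to be specified in Part II. We there show: |A^N_μ(x)| < ce^{−γ|x|}, (3.13) |DA^N_μ(x)| < ce^{−γ|x|}, (3.14) …»*; P. Federbush,
C. Williamson, *II. Analysis of a mode*, J. Math. Phys. **28** (1987) 1416–1419 [FederbushWilliamson1987PhaseCellII], (2.4)–(2.5)
p. 1417 (the printed `X`; the tree's `ModeAnalyticity.X`, `ModeAnalyticity.AN s i p = A′_i(p) + p_iX(p)`).  Unit `lit-balaban-r17`
gen 13 (fold owner of the Federbush block); SKELETON row **F1.Eq3.13-3.15** of `HOME/lit-balaban-r17/SKELETON-r17.md` (flag of r17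
g4/g10: «whether (3.13)–(3.15) hold for print's own A^N is neither proved nor refuted»), cells of F2.Thm3.1.

INPUTS BY NAME.  p04 gen 5 `ModeAnalyticityThm31Refutation.no_holomorphic_extension` (p250244): for every `s` and `0 < ρ ≤ 1/2`, NO
function `ℂ⁴ → ℂ` that is `ℂ`-differentiable on the ball `‖p‖ < ρ` agrees with `AN s 0` (print's `A^N_1`) on the real generic
momenta of that ball.  r17 `AbelianAveraging.Decay313to315` (the typed package (3.13)–(3.15), `AbelianModeEstimates`), `E4`.
Mathlib: `hasFDerivAt_integral_of_dominated_of_fderiv_le`, `integrable_one_add_norm`.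

WHAT THIS MODULE PROVES (the converse direction of the Paley–Wiener mechanism of `ModeDecayPaleyWiener`).
* §1–§2 For a continuous `f : ℝ⁴ → ℂ` with `‖f(x)‖ ≤ ce^{−γ|x|}`, `γ > 0`, the Fourier–Laplace integral
  `G_σ(p) = ∫ e^{iσ p·x} f(x) d⁴x` (any real `σ`; complex `p ∈ ℂ⁴`) is `ℂ`-(Fréchet-)differentiable on the ball `‖p‖ < ρ` as soon
  as `8|σ|ρ ≤ γ` (**`hasFDerivAt_laplaceFT`**, **`differentiableOn_laplaceFT`**): differentiation under the integral sign with the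
  dominating function `4|σ|c·|x|e^{−γ|x|/2} ≤ (16|σ|c/γ)e^{−γ|x|/4} ∈ L¹(ℝ⁴)` (`integrable_exp_neg_mul_norm`).
* §3 **`no_decaying_field_with_printed_transform`**: for every `s`, there is NO continuous, exponentially decaying `f : ℝ⁴ → ℂ`,
  constant `κ ∈ ℂ`, sign/scale `σ ∈ ℝ` and radius `ρ > 0` with `κ·G_σ(p) = AN s 0 p` for all real generic `p` with `‖p‖ < ρ` —
  i.e. under EVERY Fourier convention, print's `A^N_1` near `p = 0` is not the (inverse) transform of an exponentially decaying
  continuous field.  **`not_decay313_of_printed_transform`**: in particular no field `B : ℝ⁴ → ℝ⁴` carrying the typed package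
  `AbelianAveraging.Decay313to315 B` has first component whose transform reproduces `AN s 0` near `0` in this sense.

HONEST SCOPE.  (a) What is refuted is the conjunction «(3.13) for μ = 1» ∧ «Ã_1 = AN s 0 is, near p = 0 on the real generic momenta,
the (inverse) Fourier transform of A^N_1» — the second clause is F-I's «A^N_μ(x) is the Fourier transform of Ã(p)» read classically
(for a continuous exponentially decaying A^N_1 its inverse transform is a genuine continuous function and Fourier inversion
identifies it with Ã_1 wherever the latter is the transform datum); nothing is asserted about fields related to `AN` only in a
weaker (distributional, a.e.-up-to-polynomial) sense.  (b) Only the component μ = 1 (`i = 0` in the tree's indexing) and only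
Part II's PRINTED `X` (2.5) are concerned: p04's corrected gauge `X_c` (`ModeAnalyticityCorrectedGauge`, GAPS G-F2-01) DOES give a
mode with (3.13)–(3.15) (`CorrectedModePlaquetteVariables.decay313to315_field`, p320205), and the gauge-invariant field strength is
analytic near 0 (`ModeAnalyticityGaugeRepair`, p251790) — the defect is the printed gauge choice, exactly as located by p04 for
Theorem 3.1.  (c) Components μ = 2, 3, 4 and (3.14)–(3.15) separately are not discussed.  Theorems + three small definitions with
bodies (`coordCLM`, `laplaceFT`, `kernelDeriv`); no `Prop` fact, no `sorry`; axioms standard.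
-/

namespace Literature.MathematicalPhysics.QuantumFieldTheory.Federbush1986

noncomputable section

namespace PrintedModeNoDecay

open ModeAnalyticity ModeAnalyticityThm31Refutation MeasureTheory Metric Filter
open scoped BigOperators Topology

/-! ## §1 The Fourier–Laplace kernel `e^{iσ p·x} f(x)` for complex momenta and its `p`-derivative -/

/-- The pairing `p ↦ Σ_j x_j p_j` as a `ℂ`-linear functional on complex momenta (`x ∈ ℝ⁴` fixed).
[cite: Federbush1986PhaseCellI, (3.13) p. 328] -/
def coordCLM (x : E4) : Momentum →L[ℂ] ℂ := ∑ j, ((x j : ℝ) : ℂ) • ContinuousLinearMap.proj j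

/-- `coordCLM x p = Σ_j x_j p_j`. [cite: Federbush1986PhaseCellI, (3.13) p. 328] -/
theorem coordCLM_apply (x : E4) (p : Momentum) : coordCLM x p = ∑ j, ((x j : ℝ) : ℂ) * p j := by
  simp [coordCLM]

/-- `‖coordCLM x‖ ≤ Σ_j |x_j|` (sup norm on momenta). [cite: Federbush1986PhaseCellI, (3.13) p. 328] -/
theorem norm_coordCLM_le (x : E4) : ‖coordCLM x‖ ≤ ∑ j, |x j| := by
  refine ContinuousLinearMap.opNorm_le_bound _ (Finset.sum_nonneg fun j _ => abs_nonneg _) fun p => ?_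
  rw [coordCLM_apply, Finset.sum_mul]
  refine (norm_sum_le _ _).trans (Finset.sum_le_sum fun j _ => ?_)
  rw [norm_mul, Complex.norm_real, Real.norm_eq_abs]
  exact mul_le_mul_of_nonneg_left (norm_le_pi_norm p j) (abs_nonneg _)

/-- `Σ_j |x_j| ≤ 4‖x‖` on `ℝ⁴`. [folklore] -/
private theorem sum_abs_le_four_mul_norm (x : E4) : ∑ j, |x j| ≤ 4 * ‖x‖ := by
  calc ∑ j, |x j| ≤ ∑ _j : Fin 4, ‖x‖ := Finset.sum_le_sum fun j _ => by
          have h := PiLp.norm_apply_le x j; rwa [Real.norm_eq_abs] at h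
    _ = 4 * ‖x‖ := by simp

/-- `‖coordCLM x‖ ≤ 4‖x‖`. [cite: Federbush1986PhaseCellI, (3.13) p. 328] -/
theorem norm_coordCLM_le' (x : E4) : ‖coordCLM x‖ ≤ 4 * ‖x‖ :=
  (norm_coordCLM_le x).trans (sum_abs_le_four_mul_norm x)

/-- `x ↦ coordCLM x` is continuous. [folklore] -/
private theorem continuous_coordCLM : Continuous coordCLM := by
  unfold coordCLM
  refine continuous_finsetSum _ fun j _ => ?_
  exact (Complex.continuous_ofReal.comp ((continuous_apply j).comp (PiLp.continuous_ofLp 2 _))).smul continuous_const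

/-- The Fourier–Laplace integral `G_σ(p) = ∫ e^{iσ Σ_j x_j p_j} f(x) d⁴x` at a complex momentum `p` (`σ ∈ ℝ` fixes the sign and
scale convention). [cite: Federbush1986PhaseCellI, (3.13) p. 328 («A^N_μ(x) is the Fourier transform of Ã(p)»)] -/
def laplaceFT (σ : ℝ) (f : E4 → ℂ) (p : Momentum) : ℂ := ∫ x, Complex.exp ((σ : ℂ) * Complex.I * coordCLM x p) * f x

/-- The `p`-derivative of the kernel: `f(x)·e^{iσ x·p}·(iσ)·coordCLM x`. [cite: Federbush1986PhaseCellI, (3.13) p. 328] -/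
def kernelDeriv (σ : ℝ) (f : E4 → ℂ) (p : Momentum) (x : E4) : Momentum →L[ℂ] ℂ :=
  f x • (Complex.exp ((σ : ℂ) * Complex.I * coordCLM x p) • (((σ : ℂ) * Complex.I) • coordCLM x))

/-- The kernel is `ℂ`-differentiable in the momentum with derivative `kernelDeriv`. [folklore] -/
private theorem hasFDerivAt_kernel (σ : ℝ) (f : E4 → ℂ) (x : E4) (p : Momentum) :
    HasFDerivAt (fun q : Momentum => Complex.exp ((σ : ℂ) * Complex.I * coordCLM x q) * f x) (kernelDeriv σ f p x) p := by
  have h0 : HasFDerivAt (fun q : Momentum => (σ : ℂ) * Complex.I * coordCLM x q) (((σ : ℂ) * Complex.I) • coordCLM x) p :=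
    (coordCLM x).hasFDerivAt.const_mul _
  exact h0.cexp.mul_const (f x)

/-- `‖e^{iσ x·p}‖ ≤ e^{|σ|·(Σ_j|x_j|)·‖p‖}`. [folklore] -/
private theorem norm_cexp_le (σ : ℝ) (x : E4) (p : Momentum) :
    ‖Complex.exp ((σ : ℂ) * Complex.I * coordCLM x p)‖ ≤ Real.exp (|σ| * (4 * ‖x‖) * ‖p‖) := by
  rw [Complex.norm_exp]
  refine Real.exp_le_exp.2 ?_
  refine (le_abs_self _).trans ((Complex.abs_re_le_norm _).trans ?_)
  rw [norm_mul, norm_mul, Complex.norm_real, Complex.norm_I, mul_one, Real.norm_eq_abs, mul_assoc]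
  refine mul_le_mul_of_nonneg_left ?_ (abs_nonneg _)
  exact ((coordCLM x).le_opNorm p).trans (mul_le_mul_of_nonneg_right (norm_coordCLM_le' x) (norm_nonneg _))

/-- Norm of the kernel derivative: `‖kernelDeriv‖ ≤ ‖f(x)‖·e^{4|σ||x|‖p‖}·|σ|·4|x|`. [folklore] -/
private theorem norm_kernelDeriv_le (σ : ℝ) (f : E4 → ℂ) (p : Momentum) (x : E4) :
    ‖kernelDeriv σ f p x‖ ≤ ‖f x‖ * (Real.exp (|σ| * (4 * ‖x‖) * ‖p‖) * (|σ| * (4 * ‖x‖))) := by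
  unfold kernelDeriv
  rw [norm_smul, norm_smul, norm_smul, norm_mul, Complex.norm_real, Complex.norm_I, mul_one, Real.norm_eq_abs]
  refine mul_le_mul_of_nonneg_left ?_ (norm_nonneg _)
  exact mul_le_mul (norm_cexp_le σ x p) (mul_le_mul_of_nonneg_left (norm_coordCLM_le' x) (abs_nonneg _))
    (by positivity) (by positivity)

/-! ## §2 Integrability of the exponential majorants and differentiability of `G_σ` on a ball about `0` -/

/-- `e^{−at} ≤ m⁻⁵(1 + t)⁻⁵` for `t ≥ 0`, `m = min(1, a/5)` (`a > 0`). [folklore] -/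
private theorem exp_neg_mul_le {a t : ℝ} (ha : 0 < a) (ht : 0 ≤ t) :
    Real.exp (-(a * t)) ≤ (min 1 (a / 5))⁻¹ ^ 5 * (1 + t) ^ (-(5 : ℝ)) := by
  set m : ℝ := min 1 (a / 5) with hm
  have hm0 : 0 < m := lt_min one_pos (by positivity)
  have hm1 : m ≤ 1 := min_le_left _ _
  have hma : m ≤ a / 5 := min_le_right _ _
  -- m(1+t) ≤ 1 + (a/5) t ≤ e^{a t/5}
  have h1 : m * (1 + t) ≤ Real.exp (a * t / 5) := by
    calc m * (1 + t) = m + m * t := by ring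
      _ ≤ 1 + a / 5 * t := add_le_add hm1 (mul_le_mul_of_nonneg_right hma ht)
      _ = a * t / 5 + 1 := by ring
      _ ≤ Real.exp (a * t / 5) := Real.add_one_le_exp _
  have h5 : (m * (1 + t)) ^ 5 ≤ Real.exp (a * t) := by
    calc (m * (1 + t)) ^ 5 ≤ Real.exp (a * t / 5) ^ 5 := pow_le_pow_left₀ (by positivity) h1 5
      _ = Real.exp (a * t) := by rw [← Real.exp_nat_mul]; ring_nf
  have key : m ^ 5 * (1 + t) ^ 5 ≤ Real.exp (a * t) := by rw [← mul_pow]; exact h5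
  have hq : 0 < m ^ 5 * (1 + t) ^ 5 := by positivity
  calc Real.exp (-(a * t)) = 1 / Real.exp (a * t) := by rw [Real.exp_neg, one_div]
    _ ≤ 1 / (m ^ 5 * (1 + t) ^ 5) := one_div_le_one_div_of_le hq key
    _ = m⁻¹ ^ 5 * (1 + t) ^ (-(5 : ℝ)) := by
        rw [Real.rpow_neg (by positivity), show ((1 + t) ^ (5 : ℝ)) = (1 + t) ^ (5 : ℕ) by norm_cast, one_div, mul_inv,
          inv_pow]

/-- **`x ↦ e^{−a|x|}` is integrable on `ℝ⁴`** (`a > 0`; domination by `(1 + |x|)⁻⁵`). [folklore] -/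
private theorem integrable_exp_neg_mul_norm {a : ℝ} (ha : 0 < a) : Integrable fun x : E4 => Real.exp (-(a * ‖x‖)) := by
  have hdim : (Module.finrank ℝ E4 : ℝ) < 5 := by
    rw [finrank_euclideanSpace, Fintype.card_fin]; norm_num
  have hI := (integrable_one_add_norm (E := E4) (μ := volume) hdim).const_mul ((min 1 (a / 5))⁻¹ ^ 5)
  refine hI.mono' (by fun_prop) (ae_of_all _ fun x => ?_)
  rw [Real.norm_eq_abs, abs_of_pos (Real.exp_pos _)]
  exact exp_neg_mul_le ha (norm_nonneg x)

/-- `t·e^{−(γ/2)t} ≤ (4/γ)·e^{−(γ/4)t}` for `t ≥ 0`. [folklore] -/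
private theorem mul_exp_neg_le {γ : ℝ} (hγ : 0 < γ) (t : ℝ) :
    t * Real.exp (-(γ / 2 * t)) ≤ 4 / γ * Real.exp (-(γ / 4 * t)) := by
  have h1 : γ / 4 * t ≤ Real.exp (γ / 4 * t) := by
    have := Real.add_one_le_exp (γ / 4 * t); linarith
  have h2 : t ≤ 4 / γ * Real.exp (γ / 4 * t) := by
    rw [div_mul_eq_mul_div, le_div_iff₀ hγ]
    calc t * γ = 4 * (γ / 4 * t) := by ring
      _ ≤ 4 * Real.exp (γ / 4 * t) := by linarith
  calc t * Real.exp (-(γ / 2 * t)) ≤ 4 / γ * Real.exp (γ / 4 * t) * Real.exp (-(γ / 2 * t)) :=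
        mul_le_mul_of_nonneg_right h2 (Real.exp_pos _).le
    _ = 4 / γ * Real.exp (-(γ / 4 * t)) := by rw [mul_assoc, ← Real.exp_add]; ring_nf

/-- The constant of an exponential majorant is non-negative. [folklore] -/
private theorem const_nonneg {f : E4 → ℂ} {c γ : ℝ} (hdec : ∀ x, ‖f x‖ ≤ c * Real.exp (-γ * ‖x‖)) : 0 ≤ c := by
  have h := (norm_nonneg _).trans (hdec 0)
  rw [norm_zero, mul_zero, Real.exp_zero, mul_one] at h
  exact h

/-- **Differentiation under the integral sign**: for a continuous `f` with `‖f(x)‖ ≤ ce^{−γ|x|}` (`γ > 0`) and `8|σ|ρ ≤ γ`,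
`G_σ` has the Fréchet derivative `∫ kernelDeriv` at every point of the ball `‖p‖ < ρ`. [cite: Federbush1986PhaseCellI, (3.13) p. 328] -/
theorem hasFDerivAt_laplaceFT {f : E4 → ℂ} {c γ σ ρ : ℝ} (hγ : 0 < γ) (hf : Continuous f)
    (hdec : ∀ x, ‖f x‖ ≤ c * Real.exp (-γ * ‖x‖)) (hσρ : 8 * |σ| * ρ ≤ γ) {p₀ : Momentum} (hp₀ : p₀ ∈ ball (0 : Momentum) ρ) :
    HasFDerivAt (laplaceFT σ f) (∫ x, kernelDeriv σ f p₀ x) p₀ := by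
  have hc := const_nonneg hdec
  have hρ : 0 < ρ := lt_of_le_of_lt (norm_nonneg p₀) (mem_ball_zero_iff.1 hp₀)
  -- continuity of the kernel and of its derivative in `x`
  have hexpc : ∀ p : Momentum, Continuous fun x : E4 => Complex.exp ((σ : ℂ) * Complex.I * coordCLM x p) := fun p =>
    Complex.continuous_exp.comp (continuous_const.mul (continuous_coordCLM.clm_apply continuous_const))
  have hFc : ∀ p : Momentum, Continuous fun x : E4 => Complex.exp ((σ : ℂ) * Complex.I * coordCLM x p) * f x :=
    fun p => (hexpc p).mul hf
  have hF'c : Continuous fun x : E4 => kernelDeriv σ f p₀ x := by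
    unfold kernelDeriv
    exact hf.smul ((hexpc p₀).smul (continuous_coordCLM.const_smul ((σ : ℂ) * Complex.I)))
  -- the exponent bound on the ball: |σ|·4|x|·‖p‖ ≤ (γ/2)|x|
  have hexp : ∀ p ∈ ball (0 : Momentum) ρ, ∀ x : E4, |σ| * (4 * ‖x‖) * ‖p‖ ≤ γ / 2 * ‖x‖ := by
    intro p hp x
    have hp' : ‖p‖ ≤ ρ := (mem_ball_zero_iff.1 hp).le
    calc |σ| * (4 * ‖x‖) * ‖p‖ ≤ |σ| * (4 * ‖x‖) * ρ := mul_le_mul_of_nonneg_left hp' (by positivity)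
      _ = (8 * |σ| * ρ) / 2 * ‖x‖ := by ring
      _ ≤ γ / 2 * ‖x‖ := by
          refine mul_le_mul_of_nonneg_right ?_ (norm_nonneg _); linarith
  -- the dominating function
  set bound : E4 → ℝ := fun x => 16 * |σ| * c / γ * Real.exp (-(γ / 4 * ‖x‖)) with hbound
  have hbint : Integrable bound := by
    have h4 : 0 < γ / 4 := by positivity
    have := (integrable_exp_neg_mul_norm (a := γ / 4) h4).const_mul (16 * |σ| * c / γ)
    exact this
  have hdom : ∀ x : E4, ∀ p ∈ ball (0 : Momentum) ρ, ‖kernelDeriv σ f p x‖ ≤ bound x := by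
    intro x p hp
    refine (norm_kernelDeriv_le σ f p x).trans ?_
    have hx := norm_nonneg x
    have e1 : Real.exp (|σ| * (4 * ‖x‖) * ‖p‖) ≤ Real.exp (γ / 2 * ‖x‖) := Real.exp_le_exp.2 (hexp p hp x)
    calc ‖f x‖ * (Real.exp (|σ| * (4 * ‖x‖) * ‖p‖) * (|σ| * (4 * ‖x‖)))
        ≤ (c * Real.exp (-γ * ‖x‖)) * (Real.exp (γ / 2 * ‖x‖) * (|σ| * (4 * ‖x‖))) :=
          mul_le_mul (hdec x) (mul_le_mul_of_nonneg_right e1 (by positivity)) (by positivity) (by positivity)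
      _ = 4 * |σ| * c * (‖x‖ * Real.exp (-(γ / 2 * ‖x‖))) := by
          have : Real.exp (-γ * ‖x‖) * Real.exp (γ / 2 * ‖x‖) = Real.exp (-(γ / 2 * ‖x‖)) := by
            rw [← Real.exp_add]; ring_nf
          calc (c * Real.exp (-γ * ‖x‖)) * (Real.exp (γ / 2 * ‖x‖) * (|σ| * (4 * ‖x‖)))
              = 4 * |σ| * c * ‖x‖ * (Real.exp (-γ * ‖x‖) * Real.exp (γ / 2 * ‖x‖)) := by ring
            _ = 4 * |σ| * c * (‖x‖ * Real.exp (-(γ / 2 * ‖x‖))) := by rw [this]; ring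
      _ ≤ 4 * |σ| * c * (4 / γ * Real.exp (-(γ / 4 * ‖x‖))) :=
          mul_le_mul_of_nonneg_left (mul_exp_neg_le hγ ‖x‖) (by positivity)
      _ = bound x := by simp only [hbound]; ring
  -- integrability of the kernel at p₀
  have hint : Integrable fun x : E4 => Complex.exp ((σ : ℂ) * Complex.I * coordCLM x p₀) * f x := by
    have h2 : 0 < γ / 2 := by positivity
    refine ((integrable_exp_neg_mul_norm h2).const_mul c).mono' (hFc p₀).aestronglyMeasurable (ae_of_all _ fun x => ?_)
    rw [norm_mul]
    have e1 : Real.exp (|σ| * (4 * ‖x‖) * ‖p₀‖) ≤ Real.exp (γ / 2 * ‖x‖) := Real.exp_le_exp.2 (hexp p₀ hp₀ x)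
    calc ‖Complex.exp ((σ : ℂ) * Complex.I * coordCLM x p₀)‖ * ‖f x‖
        ≤ Real.exp (γ / 2 * ‖x‖) * (c * Real.exp (-γ * ‖x‖)) :=
          mul_le_mul ((norm_cexp_le σ x p₀).trans e1) (hdec x) (norm_nonneg _) (Real.exp_pos _).le
      _ = c * Real.exp (-(γ / 2 * ‖x‖)) := by
          rw [mul_left_comm, ← Real.exp_add]; ring_nf
  exact hasFDerivAt_integral_of_dominated_of_fderiv_le (F' := fun p x => kernelDeriv σ f p x) (bound := bound)
    (isOpen_ball.mem_nhds hp₀) (Eventually.of_forall fun p => (hFc p).aestronglyMeasurable) hint hF'c.aestronglyMeasurable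
    (Eventually.of_forall fun x p hp => hdom x p hp) hbint (Eventually.of_forall fun x p _ => hasFDerivAt_kernel σ f x p)

/-- **`G_σ` is `ℂ`-differentiable on the ball `‖p‖ < ρ`** (`8|σ|ρ ≤ γ`). [cite: Federbush1986PhaseCellI, (3.13) p. 328] -/
theorem differentiableOn_laplaceFT {f : E4 → ℂ} {c γ σ ρ : ℝ} (hγ : 0 < γ) (hf : Continuous f)
    (hdec : ∀ x, ‖f x‖ ≤ c * Real.exp (-γ * ‖x‖)) (hσρ : 8 * |σ| * ρ ≤ γ) :
    DifferentiableOn ℂ (laplaceFT σ f) (ball (0 : Momentum) ρ) := fun _ hp =>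
  (hasFDerivAt_laplaceFT hγ hf hdec hσρ hp).differentiableAt.differentiableWithinAt

/-! ## §3 The refutation of (3.13) for print's `A^N_1` in Part II's printed gauge -/

/-- **NO EXPONENTIALLY DECAYING CONTINUOUS FIELD HAS PRINT'S `A^N_1` AS ITS TRANSFORM NEAR `p = 0`.**  For every `s`, every
continuous `f : ℝ⁴ → ℂ` with `‖f(x)‖ ≤ ce^{−γ|x|}` (`γ > 0`), every convention `κ ∈ ℂ`, `σ ∈ ℝ` and every radius `ρ > 0`, the
identity `κ·∫e^{iσ x·p}f(x)d⁴x = A^N_1(p)` (`= ModeAnalyticity.AN s 0 p`, Part II (2.4)–(2.5) as printed) CANNOT hold for all real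
generic momenta `p` with `‖p‖ < ρ`: the left side is holomorphic near `0` (§2), the right side admits no holomorphic extension
(p04 `no_holomorphic_extension`). [cite: Federbush1986PhaseCellI, (3.13) p. 328; FederbushWilliamson1987PhaseCellII, (2.4)–(2.5),
Theorem 3.1 p. 1417] -/
theorem no_decaying_field_with_printed_transform (s : ℕ) {f : E4 → ℂ} {c γ : ℝ} (hγ : 0 < γ) (hf : Continuous f)
    (hdec : ∀ x, ‖f x‖ ≤ c * Real.exp (-γ * ‖x‖)) (κ : ℂ) (σ : ℝ) {ρ : ℝ} (hρ : 0 < ρ)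
    (hagree : ∀ p ∈ realGeneric, p ∈ ball (0 : Momentum) ρ → κ * laplaceFT σ f p = AN s 0 p) : False := by
  -- a radius small enough for both the differentiability and p04's theorem
  set ρ' : ℝ := min ρ (min (1 / 2) (γ / (8 * (|σ| + 1)))) with hρ'
  have hσ1 : 0 < |σ| + 1 := by positivity
  have hρ'pos : 0 < ρ' := lt_min hρ (lt_min one_half_pos (div_pos hγ (by positivity)))
  have hρ'half : ρ' ≤ 1 / 2 := (min_le_right _ _).trans (min_le_left _ _)
  have hρ'ρ : ρ' ≤ ρ := min_le_left _ _
  have hσρ : 8 * |σ| * ρ' ≤ γ := by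
    have h1 : ρ' ≤ γ / (8 * (|σ| + 1)) := (min_le_right _ _).trans (min_le_right _ _)
    calc 8 * |σ| * ρ' ≤ 8 * (|σ| + 1) * ρ' := mul_le_mul_of_nonneg_right (by linarith) hρ'pos.le
      _ ≤ 8 * (|σ| + 1) * (γ / (8 * (|σ| + 1))) := mul_le_mul_of_nonneg_left h1 (by positivity)
      _ = γ := by field_simp
  have hg : DifferentiableOn ℂ (fun p => κ * laplaceFT σ f p) (ball (0 : Momentum) ρ') :=
    (differentiableOn_laplaceFT hγ hf hdec hσρ).const_mul κ
  exact no_holomorphic_extension s hρ'pos hρ'half hg fun p hp hb => hagree p hp (ball_subset_ball hρ'ρ hb)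

/-- **(3.13) FAILS FOR PRINT'S `A^N` (Part II's printed gauge), component μ = 1.**  No field `B : ℝ⁴ → ℝ⁴` carrying the typed
decay package `AbelianAveraging.Decay313to315 B` ((3.13)–(3.15): `C¹`, `|B_μ(x)|, |DB_μ(x)| < ce^{−γ|x|}`, Hölder quotient) has a
first component whose Fourier–Laplace transform (any convention `κ`, `σ`) reproduces `A^N_1 = AN s 0` on the real generic momenta
near `p = 0`.  The located repair is p04's corrected gauge (`CorrectedModePlaquetteVariables.decay313to315_field`).
[cite: Federbush1986PhaseCellI, (3.13)–(3.15) p. 328; FederbushWilliamson1987PhaseCellII, (2.4)–(2.5) p. 1417] -/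
theorem not_decay313_of_printed_transform (s : ℕ) {B : E4 → Fin 4 → ℝ} (hB : AbelianAveraging.Decay313to315 B)
    (κ : ℂ) (σ : ℝ) {ρ : ℝ} (hρ : 0 < ρ)
    (hagree : ∀ p ∈ realGeneric, p ∈ ball (0 : Momentum) ρ →
      κ * laplaceFT σ (fun x => ((B x 0 : ℝ) : ℂ)) p = AN s 0 p) : False := by
  obtain ⟨c, -, γ, hγ, -, hC1, h313, -, -⟩ := hB
  have hcont : Continuous fun x : E4 => ((B x 0 : ℝ) : ℂ) :=
    Complex.continuous_ofReal.comp ((continuous_apply 0).comp hC1.continuous)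
  refine no_decaying_field_with_printed_transform s hγ hcont (c := c) (fun x => ?_) κ σ hρ hagree
  rw [Complex.norm_real, Real.norm_eq_abs]
  exact (h313 x 0).le

end PrintedModeNoDecay

end

end Literature.MathematicalPhysics.QuantumFieldTheory.Federbush1986
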